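import Mathlib
import Literature.Combinatorics.Additive.TripleProductProperty
import Summits.MatrixMultiplication.MatrixMultiplication.Theses.SnSubsetDichotomy

/-!
# Crux ThresholdSubsetTriples (stmt-MatrixMultiplication-10882) — ideator 3 sketch (round 1)

First lemmas for the two idea cards of this folder:

* `orbit-kissing-transversals`: one WHOLE host `Y` (e.g. the matching stabiliser `C(μ) = B(M)`)
  and two sets `T, U` carved as transversals from ARBITRARY subgroups `L, L'`; the TPP is exactly
  orbit kissing `L·μ ∩ L'·μ = {μ}` (conjugation orbits of the involution `μ`, i.e. orbits on
  perfect matchings).  Lemmas `tpp_subgroup_left_iff`, `centralizer_transversal_tpp`, the transfer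
  statement `OrbitKissingDesign` and `thresholdSubsetTriples_of_orbitKissingDesign`.
* `cyclic-twist-one-set`: ℤ/3-covariant triples `(X, γXγ⁻¹, γ²Xγ⁻²)`, `γ³ = 1`, are TPP iff the
  twisted cubic condition on `Q(X)γ` holds.  Lemmas `tpp_of_twist`, `twist_of_tpp`.
-/

namespace Summit.MatrixMultiplication.MatrixMultiplication.Cruxes.ThresholdSubsetTriples.Ideator3

open Literature.Combinatorics.Additive

variable {G : Type*} [Group G]

/-! ## 1. One whole subgroup host: the TPP is a two-set condition -/

/-- With a whole subgroup `Y` as first set, `TPP(Y, T, U)` says exactly: a product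
`t t'⁻¹ · u u'⁻¹` lies in `Y` only trivially. -/
theorem tpp_subgroup_left_iff [Fintype G] (Y : Subgroup G) [DecidablePred (· ∈ Y)]
    (T U : Finset G) :
    TripleProductProperty (Finset.univ.filter (· ∈ Y)) T U ↔
      ∀ t ∈ T, ∀ t' ∈ T, ∀ u ∈ U, ∀ u' ∈ U,
        t * t'⁻¹ * (u * u'⁻¹) ∈ Y → t = t' ∧ u = u' := by
  constructor
  · intro h t ht t' ht' u hu u' hu' hmem
    have hy : (t * t'⁻¹ * (u * u'⁻¹))⁻¹ ∈ Y := Y.inv_mem hmem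
    have key := h ((t * t'⁻¹ * (u * u'⁻¹))⁻¹) (by simpa using hy) 1 (by simp) t ht t' ht' u hu
      u' hu' (by group)
    exact ⟨key.2.1, key.2.2⟩
  · intro h s hs s' hs' t ht t' ht' u hu u' hu' hprod
    have hsY : s ∈ Y := by simpa using hs
    have hs'Y : s' ∈ Y := by simpa using hs'
    have hmem : t * t'⁻¹ * (u * u'⁻¹) ∈ Y := by
      have : t * t'⁻¹ * (u * u'⁻¹) = (s * s'⁻¹)⁻¹ := by
        rw [eq_inv_iff_mul_eq_one]
        calc t * t'⁻¹ * (u * u'⁻¹) * (s * s'⁻¹)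
            = (s * s'⁻¹)⁻¹ * (s * s'⁻¹ * (t * t'⁻¹) * (u * u'⁻¹)) * (s * s'⁻¹) := by group
          _ = 1 := by rw [hprod]; group
      rw [this]
      exact Y.inv_mem (Y.mul_mem hsY (Y.inv_mem hs'Y))
    obtain ⟨rfl, rfl⟩ := h t ht t' ht' u hu u' hu' hmem
    refine ⟨?_, rfl, rfl⟩
    have : s * s'⁻¹ = 1 := by simpa using hprod
    exact mul_inv_eq_one.mp this

/-- **Orbit-kissing transversals.**  Host = the centraliser of `μ` (for a fixed-point-free
involution of `[2m]` this is the matching stabiliser `B(M) ≅ S₂ ≀ S_m`), taken WHOLE; `T ⊆ L`,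
`U ⊆ L'` with injective footprints `t ↦ t⁻¹ μ t`; and the only hypothesis linking `L` and `L'` is
that the conjugation orbits of `μ` under `L` and `L'` meet only in `μ` ("kiss").  Then
`(C(μ), T, U)` has the TPP — whatever `L ∩ C(μ)`, `L' ∩ C(μ)`, `L ∩ L'` are. -/
theorem centralizer_transversal_tpp [Fintype G] [DecidableEq G] (μ : G) (L L' : Subgroup G)
    (hkiss : ∀ l ∈ L, ∀ l' ∈ L', l * μ * l⁻¹ = l' * μ * l'⁻¹ → l * μ * l⁻¹ = μ)
    (T U : Finset G) (hT : ∀ t ∈ T, t ∈ L) (hU : ∀ u ∈ U, u ∈ L')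
    (hTi : ∀ t ∈ T, ∀ t' ∈ T, t⁻¹ * μ * t = t'⁻¹ * μ * t' → t = t')
    (hUi : ∀ u ∈ U, ∀ u' ∈ U, u⁻¹ * μ * u = u'⁻¹ * μ * u' → u = u') :
    TripleProductProperty (Finset.univ.filter (fun s : G => s * μ = μ * s)) T U := by
  intro s hs s' hs' t ht t' ht' u hu u' hu' hprod
  have hsc : s * μ = μ * s := by simpa using hs
  have hs'c : s' * μ = μ * s' := by simpa using hs'
  -- y := s s'⁻¹ commutes with μ, and (t t'⁻¹)(u u'⁻¹) = y⁻¹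
  set y : G := s * s'⁻¹ with hy
  have hyc : y * μ = μ * y := by
    have h1 : s'⁻¹ * μ = μ * s'⁻¹ := by
      calc s'⁻¹ * μ = s'⁻¹ * (μ * s') * s'⁻¹ := by group
        _ = s'⁻¹ * (s' * μ) * s'⁻¹ := by rw [hs'c]
        _ = μ * s'⁻¹ := by group
    calc y * μ = s * (s'⁻¹ * μ) := by rw [hy]; group
      _ = s * (μ * s'⁻¹) := by rw [h1]
      _ = (s * μ) * s'⁻¹ := by group
      _ = (μ * s) * s'⁻¹ := by rw [hsc]
      _ = μ * y := by rw [hy]; group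
  have hrel : t * t'⁻¹ * (u * u'⁻¹) = y⁻¹ := by
    rw [eq_inv_iff_mul_eq_one]
    calc t * t'⁻¹ * (u * u'⁻¹) * y = y⁻¹ * (y * (t * t'⁻¹) * (u * u'⁻¹)) * y := by group
      _ = 1 := by rw [hy, hprod]; group
  -- l := t' t⁻¹ ∈ L and l' := u u'⁻¹ ∈ L' conjugate μ to the same element
  have hl : t' * t⁻¹ ∈ L := L.mul_mem (hT t' ht') (L.inv_mem (hT t ht))
  have hl' : u * u'⁻¹ ∈ L' := L'.mul_mem (hU u hu) (L'.inv_mem (hU u' hu'))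
  have huy : u * u'⁻¹ = (t' * t⁻¹) * y⁻¹ := by
    calc u * u'⁻¹ = (t' * t⁻¹) * (t * t'⁻¹ * (u * u'⁻¹)) := by group
      _ = (t' * t⁻¹) * y⁻¹ := by rw [hrel]
  have hyinv : y⁻¹ * μ = μ * y⁻¹ := by
    calc y⁻¹ * μ = y⁻¹ * (μ * y) * y⁻¹ := by group
      _ = y⁻¹ * (y * μ) * y⁻¹ := by rw [hyc]
      _ = μ * y⁻¹ := by group
  have hsame : (t' * t⁻¹) * μ * (t' * t⁻¹)⁻¹ = (u * u'⁻¹) * μ * (u * u'⁻¹)⁻¹ := by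
    rw [huy]
    calc (t' * t⁻¹) * μ * (t' * t⁻¹)⁻¹
        = (t' * t⁻¹) * (μ * y⁻¹) * y * (t' * t⁻¹)⁻¹ := by group
      _ = (t' * t⁻¹) * (y⁻¹ * μ) * y * (t' * t⁻¹)⁻¹ := by rw [hyinv]
      _ = t' * t⁻¹ * y⁻¹ * μ * (t' * t⁻¹ * y⁻¹)⁻¹ := by group
  have hfix : (t' * t⁻¹) * μ * (t' * t⁻¹)⁻¹ = μ := hkiss _ hl _ hl' hsame
  -- hence equal footprints, t = t'
  have htt : t = t' := by
    refine hTi t ht t' ht' ?_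
    calc t⁻¹ * μ * t = t'⁻¹ * ((t' * t⁻¹) * μ * (t' * t⁻¹)⁻¹) * t' := by group
      _ = t'⁻¹ * μ * t' := by rw [hfix]
  subst htt
  -- then u u'⁻¹ = y⁻¹ commutes with μ, so equal footprints, u = u'
  have huu : u = u' := by
    refine hUi u hu u' hu' ?_
    have hc : (u * u'⁻¹) * μ = μ * (u * u'⁻¹) := by
      rw [huy]; simp [hyinv]
    calc u⁻¹ * μ * u = u⁻¹ * (μ * (u * u'⁻¹)) * u' := by group
      _ = u⁻¹ * ((u * u'⁻¹) * μ) * u' := by rw [hc]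
      _ = u'⁻¹ * μ * u' := by group
  subst huu
  refine ⟨?_, rfl, rfl⟩
  have h1 : s * s'⁻¹ = 1 := by simpa using hprod
  exact mul_inv_eq_one.mp h1

/-! ### Transfer statement (crux currency) -/

/-- `OrbitKissingDesign`: for every `c > 0`, infinitely often, a fixed-point-free involution `μ`
of `Fin n`, two subgroups `L, L'` whose conjugation orbits through `μ` kiss, and footprint-injective
`T ⊆ L`, `U ⊆ L'` with `|C(μ)|·|T|·|U|` above the threshold.  (With `T, U` full transversals the
product is `|B(M)|·|L·M|·|L'·M|`.) -/
def OrbitKissingDesign : Prop :=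
  ∀ c : ℝ, 0 < c → ∀ n₀ : ℕ, ∃ n ≥ n₀, ∃ μ : Equiv.Perm (Fin n),
    μ * μ = 1 ∧ (∀ x, μ x ≠ x) ∧
    ∃ L L' : Subgroup (Equiv.Perm (Fin n)),
      (∀ l ∈ L, ∀ l' ∈ L', l * μ * l⁻¹ = l' * μ * l'⁻¹ → l * μ * l⁻¹ = μ) ∧
      ∃ T U : Finset (Equiv.Perm (Fin n)),
        (∀ t ∈ T, t ∈ L) ∧ (∀ u ∈ U, u ∈ L') ∧
        (∀ t ∈ T, ∀ t' ∈ T, t⁻¹ * μ * t = t'⁻¹ * μ * t' → t = t') ∧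
        (∀ u ∈ U, ∀ u' ∈ U, u⁻¹ * μ * u = u'⁻¹ * μ * u' → u = u') ∧
        (n.factorial : ℝ) ^ ((3 : ℝ) / 2) * Real.exp (-(c * Real.sqrt (n : ℝ))) <
          (((Finset.univ.filter (fun s : Equiv.Perm (Fin n) => s * μ = μ * s)).card *
              T.card * U.card : ℕ) : ℝ)

/-- The transfer: an orbit-kissing design is a threshold TPP subset triple (crux 10882). -/
theorem thresholdSubsetTriples_of_orbitKissingDesign (h : OrbitKissingDesign) :
    Summit.MatrixMultiplication.MatrixMultiplication.Theses.SnSubsetDichotomy.ThresholdSubsetTriples := by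
  intro c hc n₀
  obtain ⟨n, hn, μ, -, -, L, L', hkiss, T, U, hT, hU, hTi, hUi, hbig⟩ := h c hc n₀
  exact ⟨n, hn, _, T, U, centralizer_transversal_tpp μ L L' hkiss T U hT hU hTi hUi, hbig⟩

/-! ## 2. ℤ/3-covariant triples: one set and a twist of order three -/

/-- If `γ³ = 1` and the translate `Q(X)γ` of the right quotient set is "3-product-free except
trivially", then `(X, γXγ⁻¹, γ²Xγ⁻²)` has the TPP. -/
theorem tpp_of_twist [DecidableEq G] (X : Finset G) (γ : G) (hγ : γ ^ 3 = 1)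
    (htw : ∀ a ∈ X, ∀ a' ∈ X, ∀ b ∈ X, ∀ b' ∈ X, ∀ c ∈ X, ∀ c' ∈ X,
      a * a'⁻¹ * γ * (b * b'⁻¹) * γ * (c * c'⁻¹) * γ = 1 → a = a' ∧ b = b' ∧ c = c') :
    TripleProductProperty X (X.image (fun x => γ * x * γ⁻¹))
      (X.image (fun x => γ ^ 2 * x * (γ ^ 2)⁻¹)) := by
  intro s hs s' hs' t ht t' ht' u hu u' hu' hprod
  obtain ⟨b, hb, rfl⟩ := Finset.mem_image.mp ht
  obtain ⟨b', hb', rfl⟩ := Finset.mem_image.mp ht'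
  obtain ⟨c, hc, rfl⟩ := Finset.mem_image.mp hu
  obtain ⟨c', hc', rfl⟩ := Finset.mem_image.mp hu'
  have key : s * s'⁻¹ * γ * (b * b'⁻¹) * γ * (c * c'⁻¹) * γ = 1 := by
    calc s * s'⁻¹ * γ * (b * b'⁻¹) * γ * (c * c'⁻¹) * γ
        = (s * s'⁻¹ * (γ * b * γ⁻¹ * (γ * b' * γ⁻¹)⁻¹) *
            (γ ^ 2 * c * (γ ^ 2)⁻¹ * (γ ^ 2 * c' * (γ ^ 2)⁻¹)⁻¹)) * γ ^ 3 := by group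
      _ = 1 := by rw [hprod, hγ, one_mul]
  obtain ⟨h1, h2, h3⟩ := htw s hs s' hs' b hb b' hb' c hc c' hc' key
  subst h1; subst h2; subst h3
  exact ⟨rfl, rfl, rfl⟩

/-- Converse: the TPP of the covariant triple gives back the twisted cubic condition. -/
theorem twist_of_tpp [DecidableEq G] (X : Finset G) (γ : G) (hγ : γ ^ 3 = 1)
    (h : TripleProductProperty X (X.image (fun x => γ * x * γ⁻¹))
      (X.image (fun x => γ ^ 2 * x * (γ ^ 2)⁻¹))) :
    ∀ a ∈ X, ∀ a' ∈ X, ∀ b ∈ X, ∀ b' ∈ X, ∀ c ∈ X, ∀ c' ∈ X,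
      a * a'⁻¹ * γ * (b * b'⁻¹) * γ * (c * c'⁻¹) * γ = 1 → a = a' ∧ b = b' ∧ c = c' := by
  intro a ha a' ha' b hb b' hb' c hc c' hc' hcub
  have hprod : a * a'⁻¹ * (γ * b * γ⁻¹ * (γ * b' * γ⁻¹)⁻¹) *
      (γ ^ 2 * c * (γ ^ 2)⁻¹ * (γ ^ 2 * c' * (γ ^ 2)⁻¹)⁻¹) = 1 := by
    calc a * a'⁻¹ * (γ * b * γ⁻¹ * (γ * b' * γ⁻¹)⁻¹) *
          (γ ^ 2 * c * (γ ^ 2)⁻¹ * (γ ^ 2 * c' * (γ ^ 2)⁻¹)⁻¹)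
        = (a * a'⁻¹ * γ * (b * b'⁻¹) * γ * (c * c'⁻¹) * γ) * (γ ^ 3)⁻¹ := by group
      _ = 1 := by rw [hcub, hγ]; group
  obtain ⟨h1, h2, h3⟩ := h a ha a' ha' _ (Finset.mem_image_of_mem _ hb) _
    (Finset.mem_image_of_mem _ hb') _ (Finset.mem_image_of_mem _ hc) _
    (Finset.mem_image_of_mem _ hc') hprod
  refine ⟨h1, ?_, ?_⟩
  · simpa [mul_left_inj, mul_right_inj] using h2
  · simpa [mul_left_inj, mul_right_inj] using h3

/-- `CovariantTwistDesign` (crux currency for card 2): one set `X ⊆ S_n` and a twist `γ`,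
`γ³ = 1`, with the twisted cubic condition and `|X|³` above the threshold. -/
def CovariantTwistDesign : Prop :=
  ∀ c : ℝ, 0 < c → ∀ n₀ : ℕ, ∃ n ≥ n₀, ∃ γ : Equiv.Perm (Fin n), γ ^ 3 = 1 ∧
    ∃ X : Finset (Equiv.Perm (Fin n)),
      (∀ a ∈ X, ∀ a' ∈ X, ∀ b ∈ X, ∀ b' ∈ X, ∀ c ∈ X, ∀ c' ∈ X,
        a * a'⁻¹ * γ * (b * b'⁻¹) * γ * (c * c'⁻¹) * γ = 1 → a = a' ∧ b = b' ∧ c = c') ∧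
      (n.factorial : ℝ) ^ ((3 : ℝ) / 2) * Real.exp (-(c * Real.sqrt (n : ℝ))) <
        ((X.card * X.card * X.card : ℕ) : ℝ)

theorem thresholdSubsetTriples_of_covariantTwistDesign (h : CovariantTwistDesign) :
    Summit.MatrixMultiplication.MatrixMultiplication.Theses.SnSubsetDichotomy.ThresholdSubsetTriples := by
  intro c hc n₀
  obtain ⟨n, hn, γ, hγ, X, htw, hbig⟩ := h c hc n₀
  refine ⟨n, hn, X, X.image (fun x => γ * x * γ⁻¹), X.image (fun x => γ ^ 2 * x * (γ ^ 2)⁻¹),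
    tpp_of_twist X γ hγ htw, ?_⟩
  have hinj1 : Function.Injective (fun x : Equiv.Perm (Fin n) => γ * x * γ⁻¹) := by
    intro x y hxy; simpa [mul_left_inj, mul_right_inj] using hxy
  have hinj2 : Function.Injective (fun x : Equiv.Perm (Fin n) => γ ^ 2 * x * (γ ^ 2)⁻¹) := by
    intro x y hxy; simpa [mul_left_inj, mul_right_inj] using hxy
  rw [Finset.card_image_of_injective _ hinj1, Finset.card_image_of_injective _ hinj2]
  exact hbig

end Summit.MatrixMultiplication.MatrixMultiplication.Cruxes.ThresholdSubsetTriples.Ideator3
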